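import Summits.ValiantsHypothesis.ValiantsHypothesis.Theorems.NewtonUnitEquationsTwoProductsRankOneThreeFreeLawLaw
import Summits.ValiantsHypothesis.ValiantsHypothesis.Theorems.NewtonUnitEquationsTwoProductsRankOneAPLawCount
import HarnessLib

/-!
# Route NewtonUnitEquations — crux `TwoProducts` (stmt-ValiantsHypothesis-5906), line `relation_ladder`, rung R7b (rank one on THREE
# letters, ALL coefficient patterns `p•α = q•β + r•γ`) + rung R7c (TWO letters with torsion): the DILATED FREE LIFT — part 1/7 — relation data `(p;q,r)`, the dilated free substitution, fibres with divisibility guards (T2–T3)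

(T2) `QIdx` (indices `a b c`, coefficients `p q ≥ 1`, `r`), `frM` (`Y_a ↦ Y_b^q Y_c^r, Y_b ↦ Y_b^p, Y_c ↦ Y_c^p`); (T3) reduced exponents, admissible fibre parameters `Adm`/`KR`, `Lof`, degrees, `Bk`, `Pfac`.

val-idea-8 g3 (ideator; lens decomp), 2026-08-28.  THE GENERAL THREE-LETTER RANK-ONE LAW `p•α = q•β + r•γ` (all `p, q ≥ 1`, `r ≥ 0`):
lift `α ↦ Y_b^q Y_c^r, β ↦ Y_b^p, γ ↦ Y_c^p` over the `p`-DILATED plane (`enumP : b ↦ β, c ↦ γ, i ↦ p•enum i`), fibres `k` with divisibility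
guards `p ∣ x_b − qk`, `p ∣ x_c − rk`, letter count `B_k = k + (x_b−qk)/p + (x_c−rk)/p`, DOUBLE SLICING `(b₁, b₂) = (x_b, x_c)`, the coefficient
theorem with `Pfac · C(R + B_k − 1, B_k) · κ_k`, finite SHIFT RANK and val-lit-p3's `ShiftRank.pencilCount` BY NAME; large or absent
coefficients/letters are permutation type (R3♯).  Instances: R6b (1;1,1), R6c (2;1,1), R7a (p = 1, `visible_bound_free`), R6d = val-lit-p3's
homogeneous shape (p = q + r, `visible_bound_hom`), and rung R7c = rank one on TWO letters with torsion `p•α = q•β` (`r = 0`, idle third letter).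

PORT NOTE (val-lit-p3 g15, prover seat, helper mode `--supports stmt-ValiantsHypothesis-5906 --as helper`, no stub credit claimed; the author's
request val-width INBOX 12:15Z/12:19Z + desk RULING #279 (c)): part 1/7 of a VERBATIM Theorems-side port of val-idea-8 g3's sorry-free module
`Cruxes/TwoProducts/Lines/relation_ladder_R7b.lean` REV 2 (tree sha256 f9e10d1fedcbd387…; 1 890 lines; `lean check` rc 0, 0 sorries,
0 warnings, axioms standard).  ALL mathematics and ALL proofs are val-idea-8 g3's.  Port changes only: (i) file split + import chain;
(ii) declarations re-declared verbatim from LANDED ports are referenced BY NAME instead — `R6b.sum_sgn`, `R6b.HSD` (+ six closure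
lemmas), `R6b.hsd_binChar` (R6b port); `tab`, `sgn`, `toolBound_mono` (R6 port, parent namespace); `R7a.SIdx`, `R7a.card_SIdx`,
`R7a.msetT_apply_le`, `R7a.permType_of_rankOne_largeCoeff`, `R7a.permType_of_rankOne_absent` (R7a port); `rankOne_symm` =
`R6c.rankOneCoincidences_symm` (R6c); `wt_nsmul'` = `FormalLogLinearisation.wt_nsmul`; (iii) section variables α-renamed `I ↦ Ig`
(QIdx datum), `D ↦ Dg` (RelData datum) — forced by the gate's textual statement index (`dedup.landed`), since the R6b / R7a ports own
same-text lemmas over `ThreeIdx` / `QIdx`; (iv) docstrings on API lemmas; (v) in part 7/7 the parameter-free `def RankOneThreeGenLaw : Prop`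
and `def RankOneTwoLaw : Prop` are NOT declared (relocation rule) — the laws are stated by their LITERAL bodies as `rankOneThreeGenLaw_proof`
and `rankOneTwoLaw_proof`; `visible_bound_free` / `visible_bound_hom` keep their names and texts.  Namespace = the author's
(`…PermutationType.R7b`).  Nothing here closes the line's residual, the crux `TwoProducts` (5906) or `VP ≠ VNP`; no summit statement is proved.

Honest scope (the author's): rank one on FOUR letters with general coefficients, relations on ≥ 5 letters, one-sided `p•α = Σ qᵢ βᵢ` (R8, memo
only) and coincidence rank ≥ 2 are NOT covered here.  Nothing here moves VP ≠ VNP; `TwoProducts` (5906) stays OPEN. [folklore]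

Cut table (source lines of `Lines/relation_ladder_R7b.lean` REV 2): part 1 `…Free` = l. 39–300 (T2–T3: `QIdx`, `frM`, fibres with
divisibility guards `Adm`/`KR`, `Bk`, `Pfac`); part 2 `…Slice` = l. 301–389 + 390–551 (`kap`, `multinomial_Lof_eq`, `coeff_phiT_frM`; T4 slice
functions, THE COEFFICIENT THEOREM `coeff_free_logTrunc`); part 3 `…SliceExc` = l. 552–754; part 4 `…ShiftPlanar` = l. 756–930 + 931–1146 (T5
`Fsl_shift`; T7 `RelData`, dilation `dilE`/`enumP`, injectivity, lifted visible points); part 5 `…Slicing` = l. 1147–1179 + 1185–1329 (dilated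
letter weights `rWP`, `lwt_split`; T8 `sliceMin_of_visible`, `Nm8`, `sliceBd8`, `sliceCount`); part 6 `…Count` = l. 1330–1447 + 1529–1620
(`RelData.count`, arithmetic `arith_R7b`, c = 906); part 7 `…Law` = l. 1622–1885 (`rankOneThreeGenLaw_proof`, `visible_bound_free/hom`, R7c
`rankOneTwoLaw_proof`).  Dropped as duplicates of landed decls: l. 393–401, 760–830, 903–909, 1007–1011, 1307–1316, 1448–1528, 1703–1709;
l. 1626–1635 / 1792–1800 (the two `def … : Prop`) replaced by literal bodies.
-/

noncomputable section

-- Sub = Summit single-conjunct layout: the duplicated namespace component is mandated by the tree.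
set_option linter.dupNamespace false
set_option linter.unusedSimpArgs false
set_option linter.deprecated false
set_option linter.unusedSectionVars false
set_option linter.unusedVariables false
set_option linter.unnecessarySeqFocus false

namespace Summit.ValiantsHypothesis.ValiantsHypothesis.Theorems.NewtonUnitEquations.TwoProducts.PermutationType
namespace R7b
open scoped BigOperators
open MvPolynomial

variable {σ : Type*} [Fintype σ] [DecidableEq σ]

/-! ## Part T2: relation indices with coefficients and the substitution `Y_a ↦ Y_b^q Y_c^r`, `Y_b ↦ Y_b^p`, `Y_c ↦ Y_c^p` -/

/-- Three distinct indices and the three coefficients of the relation `p α = q β + r γ` (`p, q ≥ 1`, `r ≥ 0`; `r = 0` with an idle third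
index `c` is the two-letter torsion relation `p α = q β`). [folklore] -/
structure QIdx (σ : Type*) where
  /-- index of `α` (idle upstairs) -/
  a : σ
  /-- index of `β` (first slice coordinate) -/
  b : σ
  /-- index of `γ` (second slice coordinate) -/
  c : σ
  /-- coefficient of `β` -/
  q : ℕ
  /-- coefficient of `γ` -/
  r : ℕ
  /-- coefficient of `α` -/
  p : ℕ
  hq : 1 ≤ q
  hp : 1 ≤ p
  hab : a ≠ b
  hac : a ≠ c
  hbc : b ≠ c

variable (Ig : QIdx σ)

/-- The substitution on letters: `α ↦ q β + r γ`, `β ↦ p β`, `γ ↦ p γ`, all other letters unchanged. [folklore] -/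
def frM (i : σ) : σ →₀ ℕ :=
  if i = Ig.a then Finsupp.single Ig.b Ig.q + Finsupp.single Ig.c Ig.r
  else if i = Ig.b then Finsupp.single Ig.b Ig.p
  else if i = Ig.c then Finsupp.single Ig.c Ig.p
  else Finsupp.single i 1

/-- `frM_a` — technical lemma of the R7b dilated free-lift toolkit (val-idea-8 g3). [folklore] -/
theorem frM_a : frM Ig Ig.a = Finsupp.single Ig.b Ig.q + Finsupp.single Ig.c Ig.r := by
  unfold frM; rw [if_pos rfl]

/-- `frM_b` — technical lemma of the R7b dilated free-lift toolkit (val-idea-8 g3). [folklore] -/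
theorem frM_b : frM Ig Ig.b = Finsupp.single Ig.b Ig.p := by
  unfold frM; rw [if_neg (fun h => Ig.hab h.symm), if_pos rfl]

/-- `frM_c` — technical lemma of the R7b dilated free-lift toolkit (val-idea-8 g3). [folklore] -/
theorem frM_c : frM Ig Ig.c = Finsupp.single Ig.c Ig.p := by
  unfold frM; rw [if_neg (fun h => Ig.hac h.symm), if_neg (fun h => Ig.hbc h.symm), if_pos rfl]

/-- `frM_other` — technical lemma of the R7b dilated free-lift toolkit (val-idea-8 g3). [folklore] -/
theorem frM_other (i : σ) (ha : i ≠ Ig.a) (hb : i ≠ Ig.b) (hc : i ≠ Ig.c) : frM Ig i = Finsupp.single i 1 := by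
  unfold frM; rw [if_neg ha, if_neg hb, if_neg hc]

/-- `frM_ne_zero` — technical lemma of the R7b dilated free-lift toolkit (val-idea-8 g3). [folklore] -/
theorem frM_ne_zero (i : σ) : frM Ig i ≠ 0 := by
  have hq := Ig.hq
  have hp := Ig.hp
  unfold frM
  split_ifs <;> intro h
  · have := DFunLike.congr_fun h Ig.b
    simp [Finsupp.single_apply, Ig.hbc, Ig.hbc.symm] at this
    omega
  · have := DFunLike.congr_fun h Ig.b; simp at this; omega
  · have := DFunLike.congr_fun h Ig.c; simp at this; omega
  · have := DFunLike.congr_fun h i; simp at this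

/-- The `a`-coordinate of a toric image vanishes. [folklore] -/
theorem piT_frM_a (L : σ →₀ ℕ) : piT (frM Ig) L Ig.a = 0 := by
  have F := And.intro Ig.hab (And.intro Ig.hac Ig.hbc)
  rw [piT_apply]
  refine Finset.sum_eq_zero fun i _ => ?_
  unfold frM
  split_ifs with h1 h2 h3 <;>
    simp [Finsupp.single_apply, h1, F.1, F.2.1, F.2.2, F.1.symm, F.2.1.symm, F.2.2.symm]

/-- The `b`-coordinate of a toric image: `q #α + p #β`. [folklore] -/
theorem piT_frM_b (L : σ →₀ ℕ) : piT (frM Ig) L Ig.b = Ig.q * L Ig.a + Ig.p * L Ig.b := by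
  have F := And.intro Ig.hab (And.intro Ig.hac Ig.hbc)
  rw [piT_apply]
  have key : ∀ i, L i * (frM Ig i) Ig.b = (if i = Ig.a then Ig.q * L i else 0) + (if i = Ig.b then Ig.p * L i else 0) := by
    intro i
    unfold frM
    split_ifs with h1 h2 h3 <;>
      simp [Finsupp.single_apply, F.1, F.2.1, F.2.2, F.1.symm, F.2.1.symm, F.2.2.symm] <;> simp_all <;> ring
  simp only [key, Finset.sum_add_distrib, Finset.sum_ite_eq', Finset.mem_univ, if_true]

/-- The `c`-coordinate of a toric image: `r #α + p #γ`. [folklore] -/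
theorem piT_frM_c (L : σ →₀ ℕ) : piT (frM Ig) L Ig.c = Ig.r * L Ig.a + Ig.p * L Ig.c := by
  have F := And.intro Ig.hab (And.intro Ig.hac Ig.hbc)
  rw [piT_apply]
  have key : ∀ i, L i * (frM Ig i) Ig.c = (if i = Ig.a then Ig.r * L i else 0) + (if i = Ig.c then Ig.p * L i else 0) := by
    intro i
    unfold frM
    split_ifs with h1 h2 h3 <;>
      simp [Finsupp.single_apply, F.1, F.2.1, F.2.2, F.1.symm, F.2.1.symm, F.2.2.symm] <;> simp_all <;> ring
  simp only [key, Finset.sum_add_distrib, Finset.sum_ite_eq', Finset.mem_univ, if_true]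

/-- Other coordinates of a toric image are unchanged. [folklore] -/
theorem piT_frM_other (L : σ →₀ ℕ) (j : σ) (ha : j ≠ Ig.a) (hb : j ≠ Ig.b) (hc : j ≠ Ig.c) : piT (frM Ig) L j = L j := by
  have F := And.intro Ig.hab (And.intro Ig.hac Ig.hbc)
  rw [piT_apply]
  have key : ∀ i, L i * (frM Ig i) j = (if i = j then L i else 0) := by
    intro i
    unfold frM
    split_ifs with h1 h2 h3 <;>
      simp [Finsupp.single_apply, ha, hb, hc, Ne.symm ha, Ne.symm hb, Ne.symm hc,
        F.1, F.2.1, F.2.2, F.1.symm, F.2.1.symm, F.2.2.symm] <;> simp_all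
  simp only [key]
  rw [Finset.sum_ite_eq']; simp

/-! ## Part T3: the three special coordinates, the reduced exponent (all three zeroed), the fibres -/

/-- The three relation indices as a finset. [folklore] -/
def threeSet : Finset σ := {Ig.a, Ig.b, Ig.c}

/-- The remaining indices. [folklore] -/
def rest : Finset σ := Finset.univ \ threeSet Ig

/-- `mem_rest` — technical lemma of the R7b dilated free-lift toolkit (val-idea-8 g3). [folklore] -/
theorem mem_rest (j : σ) : j ∈ rest Ig ↔ j ≠ Ig.a ∧ j ≠ Ig.b ∧ j ≠ Ig.c := by
  classical
  unfold rest threeSet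
  simp only [Finset.mem_sdiff, Finset.mem_univ, true_and, Finset.mem_insert, Finset.mem_singleton, not_or]

/-- `prod_three_split` — technical lemma of the R7b dilated free-lift toolkit (val-idea-8 g3). [folklore] -/
theorem prod_three_split {β : Type*} [CommMonoid β] (f : σ → β) :
    ∏ j, f j = (∏ j ∈ rest Ig, f j) * (f Ig.a * (f Ig.b * f Ig.c)) := by
  classical
  unfold rest threeSet
  rw [← Finset.prod_sdiff (Finset.subset_univ ({Ig.a, Ig.b, Ig.c} : Finset σ))]
  congr 1
  rw [Finset.prod_insert (by simp [Ig.hab, Ig.hac]), Finset.prod_pair Ig.hbc]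

/-- `sum_three_split` — technical lemma of the R7b dilated free-lift toolkit (val-idea-8 g3). [folklore] -/
theorem sum_three_split {β : Type*} [AddCommMonoid β] (f : σ → β) :
    ∑ j, f j = (∑ j ∈ rest Ig, f j) + (f Ig.a + (f Ig.b + f Ig.c)) := by
  classical
  unfold rest threeSet
  rw [← Finset.sum_sdiff (Finset.subset_univ ({Ig.a, Ig.b, Ig.c} : Finset σ))]
  congr 1
  rw [Finset.sum_insert (by simp [Ig.hab, Ig.hac]), Finset.sum_pair Ig.hbc]

/-- The reduced exponent `x̂`: the coordinates `a, b, c` set to zero. [folklore] -/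
def xhat (x : σ →₀ ℕ) : σ →₀ ℕ := ofFun fun j => if j = Ig.a ∨ j = Ig.b ∨ j = Ig.c then 0 else x j

/-- `xhat_a` — technical lemma of the R7b dilated free-lift toolkit (val-idea-8 g3). [folklore] -/
theorem xhat_a (x : σ →₀ ℕ) : xhat Ig x Ig.a = 0 := by
  classical simp [xhat]

/-- `xhat_b` — technical lemma of the R7b dilated free-lift toolkit (val-idea-8 g3). [folklore] -/
theorem xhat_b (x : σ →₀ ℕ) : xhat Ig x Ig.b = 0 := by
  classical simp [xhat]

/-- `xhat_c` — technical lemma of the R7b dilated free-lift toolkit (val-idea-8 g3). [folklore] -/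
theorem xhat_c (x : σ →₀ ℕ) : xhat Ig x Ig.c = 0 := by
  classical simp [xhat]

/-- `xhat_other` — technical lemma of the R7b dilated free-lift toolkit (val-idea-8 g3). [folklore] -/
theorem xhat_other (x : σ →₀ ℕ) (j : σ) (ha : j ≠ Ig.a) (hb : j ≠ Ig.b) (hc : j ≠ Ig.c) : xhat Ig x j = x j := by
  classical simp [xhat, ha, hb, hc]

/-- `xhat_rest` — technical lemma of the R7b dilated free-lift toolkit (val-idea-8 g3). [folklore] -/
theorem xhat_rest (x : σ →₀ ℕ) (j : σ) (hj : j ∈ rest Ig) : xhat Ig x j = x j := by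
  rw [mem_rest] at hj; exact xhat_other Ig x j hj.1 hj.2.1 hj.2.2

/-- The letter multiset in the fibre over `x` with `#α = k`: `#β = (x b - q k) / p, #γ = (x c - r k) / p`. [folklore] -/
def Lof (x : σ →₀ ℕ) (k : ℕ) : σ →₀ ℕ :=
  ofFun fun j => if j = Ig.a then k else if j = Ig.b then (x Ig.b - Ig.q * k) / Ig.p
    else if j = Ig.c then (x Ig.c - Ig.r * k) / Ig.p else x j

/-- `Lof_a` — technical lemma of the R7b dilated free-lift toolkit (val-idea-8 g3). [folklore] -/
theorem Lof_a (x : σ →₀ ℕ) (k : ℕ) : Lof Ig x k Ig.a = k := by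
  classical simp [Lof]

/-- `Lof_b` — technical lemma of the R7b dilated free-lift toolkit (val-idea-8 g3). [folklore] -/
theorem Lof_b (x : σ →₀ ℕ) (k : ℕ) : Lof Ig x k Ig.b = (x Ig.b - Ig.q * k) / Ig.p := by
  classical simp [Lof, Ig.hab.symm]

/-- `Lof_c` — technical lemma of the R7b dilated free-lift toolkit (val-idea-8 g3). [folklore] -/
theorem Lof_c (x : σ →₀ ℕ) (k : ℕ) : Lof Ig x k Ig.c = (x Ig.c - Ig.r * k) / Ig.p := by
  classical simp [Lof, Ig.hac.symm, Ig.hbc.symm]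

/-- `Lof_other` — technical lemma of the R7b dilated free-lift toolkit (val-idea-8 g3). [folklore] -/
theorem Lof_other (x : σ →₀ ℕ) (k : ℕ) (j : σ) (ha : j ≠ Ig.a) (hb : j ≠ Ig.b) (hc : j ≠ Ig.c) : Lof Ig x k j = x j := by
  classical simp [Lof, ha, hb, hc]

/-- Admissibility of `k = #α` in the slice `(b₁, b₂)`: `q k ≤ b₁`, `r k ≤ b₂`, `p ∣ b₁ - q k`, `p ∣ b₂ - r k`. [folklore] -/
abbrev Adm (b₁ b₂ k : ℕ) : Prop := Ig.q * k ≤ b₁ ∧ Ig.r * k ≤ b₂ ∧ Ig.p ∣ b₁ - Ig.q * k ∧ Ig.p ∣ b₂ - Ig.r * k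

/-- The admissible range of `k = #α` in the fibre over `x`. [folklore] -/
def KR (x : σ →₀ ℕ) : Finset ℕ := (Finset.range (x Ig.b + x Ig.c + 1)).filter fun k => Adm Ig (x Ig.b) (x Ig.c) k

/-- `le_qmul` — technical lemma of the R7b dilated free-lift toolkit (val-idea-8 g3). [folklore] -/
theorem le_qmul (k : ℕ) : k ≤ Ig.q * k := Nat.le_mul_of_pos_left k Ig.hq

/-- `mem_KR` — technical lemma of the R7b dilated free-lift toolkit (val-idea-8 g3). [folklore] -/
theorem mem_KR (x : σ →₀ ℕ) (k : ℕ) : k ∈ KR Ig x ↔ Adm Ig (x Ig.b) (x Ig.c) k := by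
  unfold KR
  rw [Finset.mem_filter, Finset.mem_range]
  have h1 := le_qmul Ig k
  constructor
  · exact fun h => h.2
  · intro h; exact ⟨by have := h.1; omega, h⟩

/-- (F1) Every preimage of `x` is an `Lof x k` with `k` admissible (and `x a = 0`). [folklore] -/
theorem eq_Lof_of_piT (L x : σ →₀ ℕ) (h : piT (frM Ig) L = x) :
    x Ig.a = 0 ∧ L Ig.a ∈ KR Ig x ∧ L = Lof Ig x (L Ig.a) := by
  have ha := piT_frM_a Ig L; have hb := piT_frM_b Ig L; have hc := piT_frM_c Ig L
  rw [h] at ha hb hc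
  refine ⟨ha, (mem_KR Ig x _).2 ⟨by omega, by omega, ⟨L Ig.b, by omega⟩, ⟨L Ig.c, by omega⟩⟩, ?_⟩
  ext j
  by_cases hja : j = Ig.a
  · subst hja; rw [Lof_a]
  by_cases hjb : j = Ig.b
  · subst hjb; rw [Lof_b, show x Ig.b - Ig.q * L Ig.a = Ig.p * L Ig.b by omega, Nat.mul_div_cancel_left _ Ig.hp]
  by_cases hjc : j = Ig.c
  · subst hjc; rw [Lof_c, show x Ig.c - Ig.r * L Ig.a = Ig.p * L Ig.c by omega, Nat.mul_div_cancel_left _ Ig.hp]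
  rw [Lof_other Ig x _ j hja hjb hjc, ← h, piT_frM_other Ig L j hja hjb hjc]

/-- (F2) Every admissible `Lof x k` lies in the fibre over `x` (when `x a = 0`). [folklore] -/
theorem piT_Lof (x : σ →₀ ℕ) (hx : x Ig.a = 0) (k : ℕ) (hk : k ∈ KR Ig x) : piT (frM Ig) (Lof Ig x k) = x := by
  rw [mem_KR] at hk
  ext j
  by_cases hja : j = Ig.a
  · subst hja; rw [piT_frM_a, hx]
  by_cases hjb : j = Ig.b
  · subst hjb; rw [piT_frM_b, Lof_a, Lof_b, Nat.mul_div_cancel' hk.2.2.1]; omega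
  by_cases hjc : j = Ig.c
  · subst hjc; rw [piT_frM_c, Lof_a, Lof_c, Nat.mul_div_cancel' hk.2.2.2]; omega
  rw [piT_frM_other Ig _ j hja hjb hjc, Lof_other Ig x k j hja hjb hjc]

/-- The degree of the reduced exponent: `R = Σ_{rest} x_j`. [folklore] -/
theorem deg_xhat (x : σ →₀ ℕ) : deg (xhat Ig x) = ∑ j ∈ rest Ig, x j := by
  rw [deg_eq_sum, sum_three_split Ig, xhat_a, xhat_b, xhat_c, zero_add, add_zero, add_zero]
  exact Finset.sum_congr rfl fun j hj => xhat_rest Ig x j hj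

/-- The full degree in terms of the reduced one. [folklore] -/
theorem deg_eq_deg_xhat_add (x : σ →₀ ℕ) : deg x = deg (xhat Ig x) + (x Ig.a + (x Ig.b + x Ig.c)) := by
  rw [deg_xhat, deg_eq_sum, sum_three_split Ig]

/-- The letter-count excess `B_k = k + (x_b − q k)/p + (x_c − r k)/p` of the fibre element `L_k` over `R`. [folklore] -/
def Bk (b₁ b₂ k : ℕ) : ℕ := k + (b₁ - Ig.q * k) / Ig.p + (b₂ - Ig.r * k) / Ig.p

/-- (F4) The degree along the fibre: `deg (Lof x k) = R + B_k`. [folklore] -/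
theorem deg_Lof_eq (x : σ →₀ ℕ) (k : ℕ) (hk : k ∈ KR Ig x) :
    deg (Lof Ig x k) = deg (xhat Ig x) + Bk Ig (x Ig.b) (x Ig.c) k := by
  rw [deg_xhat, deg_eq_sum, sum_three_split Ig, Lof_a, Lof_b, Lof_c]
  have : ∑ j ∈ rest Ig, (Lof Ig x k) j = ∑ j ∈ rest Ig, x j := by
    refine Finset.sum_congr rfl fun j hj => ?_
    rw [mem_rest] at hj
    rw [Lof_other Ig x k j hj.1 hj.2.1 hj.2.2]
  rw [this]; unfold Bk; omega

/-- `Bk_le` — technical lemma of the R7b dilated free-lift toolkit (val-idea-8 g3). [folklore] -/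
theorem Bk_le {b₁ b₂ k : ℕ} (hk : Adm Ig b₁ b₂ k) : Bk Ig b₁ b₂ k ≤ b₁ + b₂ := by
  have h1 := le_qmul Ig k
  have h2 := hk.1
  have d1 : (b₁ - Ig.q * k) / Ig.p ≤ b₁ - Ig.q * k := Nat.div_le_self _ _
  have d2 : (b₂ - Ig.r * k) / Ig.p ≤ b₂ - Ig.r * k := Nat.div_le_self _ _
  unfold Bk; omega

/-- `Bk_pos` — technical lemma of the R7b dilated free-lift toolkit (val-idea-8 g3). [folklore] -/
theorem Bk_pos {b₁ b₂ k : ℕ} (hk : Adm Ig b₁ b₂ k) (hb : 1 ≤ b₁ + b₂) : 1 ≤ Bk Ig b₁ b₂ k := by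
  obtain ⟨-, -, h3, h4⟩ := hk
  unfold Bk
  rcases Nat.eq_zero_or_pos k with hk0 | hk0
  · subst hk0
    simp only [mul_zero, Nat.sub_zero, zero_add] at h3 h4 ⊢
    rcases Nat.eq_zero_or_pos b₁ with hb1 | hb1
    · subst hb1
      have hd : 1 ≤ b₂ / Ig.p := Nat.div_pos (Nat.le_of_dvd (by omega) h4) Ig.hp
      rw [Nat.zero_div]; omega
    · have hd : 1 ≤ b₁ / Ig.p := Nat.div_pos (Nat.le_of_dvd hb1 h3) Ig.hp
      have hd' : 0 ≤ b₂ / Ig.p := Nat.zero_le _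
      omega
  · have : 0 ≤ (b₁ - Ig.q * k) / Ig.p := Nat.zero_le _
    have : 0 ≤ (b₂ - Ig.r * k) / Ig.p := Nat.zero_le _
    omega

/-- The slice normaliser `(R - 1)! / ∏_{rest} x_j!` (nonzero). [folklore] -/
def Pfac (x : σ →₀ ℕ) : ℂ :=
  (((deg (xhat Ig x) - 1).factorial : ℕ) : ℂ) / (((∏ j ∈ rest Ig, (x j).factorial : ℕ)) : ℂ)

/-- `Pfac_ne_zero` — technical lemma of the R7b dilated free-lift toolkit (val-idea-8 g3). [folklore] -/
theorem Pfac_ne_zero (x : σ →₀ ℕ) : Pfac Ig x ≠ 0 := by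
  unfold Pfac
  refine div_ne_zero (Nat.cast_ne_zero.mpr (Nat.factorial_ne_zero _)) (Nat.cast_ne_zero.mpr ?_)
  exact Finset.prod_ne_zero_iff.mpr fun j _ => Nat.factorial_ne_zero _


end R7b
end Summit.ValiantsHypothesis.ValiantsHypothesis.Theorems.NewtonUnitEquations.TwoProducts.PermutationType

end
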